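import Literature.Geometry.Riemannian.RicciDeTurckFlow
import Literature.Geometry.Lorentzian.IsometryProofs
import HarnessLib

/-!
# The Lie derivative of the metric in a chart: `(ℒ_Y g)_{ab} = Yᶜ ∂_c g_{ab} + g_{cb} ∂_a Yᶜ + g_{ac} ∂_b Yᶜ`
(topic `Geometry/Riemannian`)

Support file (everything proved, no named fact) for the existence direction of DeTurck's trick
(Topping 2006, §5.2, Step 2; DeTurck 1983), whose key differential-geometric input is Topping's
Prop. 1.2.1, `∂_t (ψ_t^* g_t) = ψ_t^* (∂_t g_t + ℒ_{X_t} g_t)`; that formula is proved in charts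
(`PullbackFamilyDerivative.lean`), and the present file supplies the coordinate expression of the
term `ℒ_X g` at the centre of a chart.

Let `g` be a `C^∞` pseudo-Riemannian metric on `M` (boundaryless, finite-dimensional complete
model `E`), `cov = ∇` a Levi-Civita connection of `g` (torsion-free and compatible,
`PseudoRiemannianMetric.IsLeviCivita`), `Y` a vector field differentiable at `x₀` and
`φ = extChartAt I x₀`, `τ` the trivialization of `TM` at `x₀`. Reading the metric and the field
in the chart at `x₀`,

* `metricInChart g x₀ z = Ĝ(z)`, the bilinear form `(a, b) ↦ g_y(τ_y⁻¹ a, τ_y⁻¹ b)`,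
  `y = φ⁻¹ z` (the components `g_{ab}` in the coordinate frame of the chart at `x₀`);
* `vectorInChart x₀ Y z = Ŷ(z) = τ_y (Y_y)` (the components `Yᵃ`; this is the time slice of
  `Literature.Geometry.Manifold.fieldInChart`),

we prove (`lieDerivMetric_eq_chart`) the classical coordinate formula for the Lie derivative of
the metric expressed through the connection, `ℒ_Y g (A, B) = g(∇_A Y, B) + g(A, ∇_B Y)`
(`lieDerivMetric`, `RicciDeTurckFlow.lean`; Topping 2006, (2.3.8); Andrews–Hopper 2011, (5.10)):

  `ℒ_Y g (x₀)(A, B) = DĜ(z₀)[Ŷ(z₀)](A, B) + g_{x₀}(DŶ(z₀) A, B) + g_{x₀}(A, DŶ(z₀) B)`,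

i.e. `(ℒ_Y g)_{ab} = Yᶜ ∂_c g_{ab} + g_{cb} ∂_a Yᶜ + g_{ac} ∂_b Yᶜ`, the coordinate reading of
O'Neill 1983, Ch. 9, proof of Prop. 9.25: `(L_X g)(V, W) = X⟨V, W⟩ - ⟨[X, V], W⟩ - ⟨V, [X, W]⟩
= ⟨D_V X, W⟩ + ⟨V, D_W X⟩`. *Proof.* With the canonical extensions `Ã, B̃` of `A, B` (Mathlib's
`FiberBundle.extend`: constant components in the chart at `x₀`), torsion-freeness gives
`∇_A Y = ∇_{Y₀} Ã + [Ã, Y]` and compatibility gives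
`Y₀ g(Ã, B̃) = g(∇_{Y₀} Ã, B) + g(A, ∇_{Y₀} B̃)`, whence
`ℒ_Y g (A, B) = Y₀ g(Ã, B̃) + g([Ã, Y], B) + g(A, [B̃, Y])` (the displayed chain of equivalent
identities in O'Neill's proof of Prop. 9.25); in the chart `Y₀ g(Ã, B̃) = DĜ[Ŷ](A, B)` and
`[Ã, Y] = DŶ A` (Mathlib defines the bracket through the chart at `x₀`,
`mlieBracketWithin_apply`, and the components of `Ã` are constant).

Also recorded: the values of `Ĝ`, `Ŷ`, `τ` at the centre, the constancy of extended vectors in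
the chart, the smoothness of `Ĝ` on the chart target, and the chart expression of `mvfderiv` at
the centre.

## References

* P. Topping, *Lectures on the Ricci flow*, LMS LNS 325 (2006), §1.2 (Prop. 1.2.1), §2.3
  (2.3.8) and the display before (2.3.20), §5.2 Step 2. [Topping2006]
* B. O'Neill, *Semi-Riemannian geometry with applications to relativity*, Academic Press 1983,
  Ch. 2, Def. 2.16 (Lie derivative); Ch. 3, Thm. 3.11 (D3)–(D5); Ch. 9, Def. 9.22 and
  Prop. 9.25 with its proof (p. 251). [ONeill1983]
* B. Andrews, C. Hopper, *The Ricci flow in Riemannian geometry*, LNM 2011 (2011), §5.4.2,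
  (5.10). [AndrewsHopper2011]
-/

noncomputable section

open Bundle Set Filter Function VectorField FiberBundle
open scoped Manifold ContDiff Topology

namespace Literature.Geometry.Riemannian

open Lorentzian Lorentzian.PseudoRiemannianMetric

variable {E : Type*} [NormedAddCommGroup E] [NormedSpace ℝ E] {H : Type*} [TopologicalSpace H]
  {I : ModelWithCorners ℝ E H} {M : Type*} [TopologicalSpace M] [ChartedSpace H M]
  [IsManifold I ∞ M]

/-! ### The trivialization of `TM` at `x₀`: values at the centre, extended vectors -/

section Trivialization

/-- At the centre, the inverse trivialization of `TM` at `x₀` is the identity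
(`mfderivWithin_range_extChartAt_symm`). [folklore] -/
theorem symmL_trivializationAt_self (x₀ : M) (v : E) :
    (trivializationAt E (TangentSpace I) x₀).symmL ℝ x₀ v = v := by
  rw [TangentBundle.symmL_trivializationAt (mem_chart_source H x₀),
    mfderivWithin_range_extChartAt_symm]
  rfl

/-- The fibre coordinate at `x₀` of a vector at `x₀` is the vector itself. [folklore] -/
theorem trivializationAt_apply_self_snd (x₀ : M) (v : TangentSpace I x₀) :
    (trivializationAt E (TangentSpace I) x₀ (⟨x₀, v⟩ : TangentBundle I M)).2 = v := by
  -- at the centre the trivialization is `dφ_{x₀} = id` (compare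
  -- `Lorentzian.trivializationAt_continuousLinearMapAt_self`, `SecondFundamentalFormSymm.lean`)
  rw [← (trivializationAt E (TangentSpace I) x₀).continuousLinearMapAt_apply_of_mem (R := ℝ)
    (FiberBundle.mem_baseSet_trivializationAt' x₀),
    TangentBundle.continuousLinearMapAt_trivializationAt (mem_chart_source H x₀),
    mfderiv_extChartAt_self]
  rfl

/-- **The canonical extension of a tangent vector has constant components in the chart at its
base point**: `Ã(y) = τ_y⁻¹ A` on the chart domain of `x₀` (Mathlib's `FiberBundle.extend`
unfolded). [folklore] -/
theorem extend_eq_symmL {x₀ y : M} (hy : y ∈ (chartAt H x₀).source) (A : TangentSpace I x₀) :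
    extend E A y = (trivializationAt E (TangentSpace I) x₀).symmL ℝ y A := by
  have hy' : y ∈ (trivializationAt E (TangentSpace I) x₀).baseSet := by
    rwa [TangentBundle.trivializationAt_baseSet]
  simp only [FiberBundle.extend, trivializationAt_apply_self_snd]
  rw [Trivialization.symmL_apply _ hy']

/-- The inverse of the derivative of the inverse extended chart is the derivative of the chart
(both read through Mathlib's junk-valued `ContinuousLinearMap.inverse`). [folklore] -/
theorem inverse_mfderivWithin_extChartAt_symm {x₀ y : M} (hy : y ∈ (extChartAt I x₀).source) :
    (mfderivWithin 𝓘(ℝ, E) I (extChartAt I x₀).symm (range I) (extChartAt I x₀ y)).inverse =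
      mfderiv I 𝓘(ℝ, E) (extChartAt I x₀) y := by
  exact ContinuousLinearMap.inverse_eq (mfderivWithin_extChartAt_symm_comp_mfderiv_extChartAt' hy)
    (mfderiv_extChartAt_comp_mfderivWithin_extChartAt_symm' hy)

end Trivialization

/-! ### The metric and a vector field read in the chart at `x₀` -/

section Chart

variable {n : ℕ∞ω} (g : PseudoRiemannianMetric I n E (TangentSpace I : M → Type _)) (x₀ : M)

/-- **The components of the metric at `y` in the coordinate frame of the chart at `x₀`**:
the bilinear form `(a, b) ↦ g_y(τ_y⁻¹ a, τ_y⁻¹ b)` on `E`, `τ` the trivialization of `TM` at `x₀`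
(the fibre coordinate of the section `g` of the bundle of bilinear forms in its trivialization at
`x₀`, `trivializationAt_bilin_snd` of `IsometryProofs.lean`; junk off the chart domain).
[folklore] -/
def bilinInChart (y : M) : E →L[ℝ] E →L[ℝ] ℝ :=
  (ContinuousLinearMap.precomp ℝ ((trivializationAt E (TangentSpace I) x₀).symmL ℝ y)).comp
    ((g.val y).comp ((trivializationAt E (TangentSpace I) x₀).symmL ℝ y))

/-- Unfolding lemma for `bilinInChart`. [folklore] -/
@[simp]
theorem bilinInChart_apply (y : M) (a b : E) :
    bilinInChart g x₀ y a b =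
      g.val y ((trivializationAt E (TangentSpace I) x₀).symmL ℝ y a)
        ((trivializationAt E (TangentSpace I) x₀).symmL ℝ y b) :=
  rfl

/-- On the chart domain, `g_{ab}(y) A^a B^b = g_y(Ã y, B̃ y)` for the canonical extensions
`Ã, B̃` of `A, B ∈ T_{x₀} M`. [folklore] -/
theorem bilinInChart_apply_eq_extend {x₀ y : M} (hy : y ∈ (chartAt H x₀).source)
    (A B : TangentSpace I x₀) :
    bilinInChart g x₀ y A B = g.val y (extend E A y) (extend E B y) := by
  rw [bilinInChart_apply, extend_eq_symmL hy, extend_eq_symmL hy]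

/-- At the centre, the components are the metric itself. [folklore] -/
theorem bilinInChart_self (a b : E) : bilinInChart g x₀ x₀ a b = g.val x₀ a b := by
  rw [bilinInChart_apply, symmL_trivializationAt_self, symmL_trivializationAt_self]

/-- **The metric read in the chart at `x₀`**: `Ĝ(z) = g_{ab}(φ⁻¹ z)`, the components of `g` in
the coordinate frame of the chart at `x₀` as a function of the chart coordinate `z`
(`φ = extChartAt I x₀`; junk outside the chart target), a map `E → (E →L E →L ℝ)` between normed
spaces. [folklore] -/
def metricInChart (z : E) : E →L[ℝ] E →L[ℝ] ℝ :=
  bilinInChart g x₀ ((extChartAt I x₀).symm z)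

/-- Unfolding lemma for `metricInChart`. [folklore] -/
theorem metricInChart_apply (z a b : E) :
    metricInChart g x₀ z a b =
      g.val ((extChartAt I x₀).symm z)
        ((trivializationAt E (TangentSpace I) x₀).symmL ℝ ((extChartAt I x₀).symm z) a)
        ((trivializationAt E (TangentSpace I) x₀).symmL ℝ ((extChartAt I x₀).symm z) b) :=
  rfl

/-- `Ĝ(φ y) = g_{ab}(y)` on the chart domain. [folklore] -/
theorem metricInChart_extChartAt {x₀ y : M} (hy : y ∈ (chartAt H x₀).source) :
    metricInChart g x₀ (extChartAt I x₀ y) = bilinInChart g x₀ y := by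
  have hys : y ∈ (extChartAt I x₀).source := by rwa [extChartAt_source]
  simp only [metricInChart, (extChartAt I x₀).left_inv hys]

/-- On the chart domain, `Ĝ(φ y)(A, B) = g_y(Ã y, B̃ y)` for the canonical extensions `Ã, B̃` of
`A, B ∈ T_{x₀} M`. [folklore] -/
theorem metricInChart_extChartAt_apply {x₀ y : M} (hy : y ∈ (chartAt H x₀).source)
    (A B : TangentSpace I x₀) :
    metricInChart g x₀ (extChartAt I x₀ y) A B = g.val y (extend E A y) (extend E B y) := by
  rw [metricInChart_extChartAt g hy, bilinInChart_apply_eq_extend g hy]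

/-- At the centre, `Ĝ(φ x₀) = g_{x₀}`. [folklore] -/
theorem metricInChart_self (a b : E) :
    metricInChart g x₀ (extChartAt I x₀ x₀) a b = g.val x₀ a b := by
  rw [metricInChart_extChartAt g (mem_chart_source H x₀), bilinInChart_self]

/-- **The components of a vector field at `y` in the coordinate frame of the chart at `x₀`**:
`τ_y (Y_y) ∈ E` (Mathlib's `tangentCoordChange`; junk off the chart domain). [folklore] -/
def tangentInChart (x₀ : M) (Y : Π x : M, TangentSpace I x) (y : M) : E :=
  tangentCoordChange I y x₀ y (Y y)

variable {x₀} in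
/-- On the chart domain, the components are read by the trivialization of `TM` at `x₀`.
[folklore] -/
theorem tangentInChart_eq {y : M} (hy : y ∈ (chartAt H x₀).source)
    (Y : Π x : M, TangentSpace I x) :
    tangentInChart x₀ Y y =
      (trivializationAt E (TangentSpace I) x₀).continuousLinearMapAt ℝ y (Y y) := by
  rw [TangentBundle.continuousLinearMapAt_trivializationAt_eq_core hy]
  rfl

/-- At the centre, the components are the vector itself. [folklore] -/
theorem tangentInChart_self (Y : Π x : M, TangentSpace I x) :
    tangentInChart x₀ Y x₀ = Y x₀ := by
  rw [tangentInChart_eq (mem_chart_source H x₀),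
    TangentBundle.continuousLinearMapAt_trivializationAt (mem_chart_source H x₀),
    mfderiv_extChartAt_self]
  rfl

/-- **A vector field read in the chart at `x₀`**: `Ŷ(z) = τ_y(Y_y)`, `y = φ⁻¹ z` — the
components `Yᵃ` of `Y` in the coordinate frame of the chart at `x₀` as a function of the chart
coordinate, a map `E → E` (junk outside the chart target; the time slice of
`Literature.Geometry.Manifold.fieldInChart`). [folklore] -/
def vectorInChart (x₀ : M) (Y : Π x : M, TangentSpace I x) (z : E) : E :=
  tangentInChart x₀ Y ((extChartAt I x₀).symm z)

variable {x₀} in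
/-- `Ŷ(φ y) = τ_y (Y y)` on the chart domain. [folklore] -/
theorem vectorInChart_extChartAt {y : M} (hy : y ∈ (chartAt H x₀).source)
    (Y : Π x : M, TangentSpace I x) :
    vectorInChart x₀ Y (extChartAt I x₀ y) =
      (trivializationAt E (TangentSpace I) x₀).continuousLinearMapAt ℝ y (Y y) := by
  have hys : y ∈ (extChartAt I x₀).source := by rwa [extChartAt_source]
  simp only [vectorInChart, (extChartAt I x₀).left_inv hys]
  exact tangentInChart_eq hy Y

/-- At the centre, `Ŷ(φ x₀) = Y_{x₀}`. [folklore] -/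
theorem vectorInChart_self (Y : Π x : M, TangentSpace I x) :
    vectorInChart x₀ Y (extChartAt I x₀ x₀) = Y x₀ := by
  rw [vectorInChart_extChartAt (mem_chart_source H x₀),
    TangentBundle.continuousLinearMapAt_trivializationAt (mem_chart_source H x₀),
    mfderiv_extChartAt_self]
  rfl

/-- **Extended vectors have constant components**: `Ŷ ≡ A` on the chart target for `Y = Ã` the
canonical extension of `A ∈ T_{x₀} M`. [folklore] -/
theorem vectorInChart_extend {z : E} (hz : z ∈ (extChartAt I x₀).target)
    (A : TangentSpace I x₀) : vectorInChart x₀ (extend E A) z = A := by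
  set y := (extChartAt I x₀).symm z with hy_def
  have hys : y ∈ (extChartAt I x₀).source := (extChartAt I x₀).map_target hz
  have hy : y ∈ (chartAt H x₀).source := by rwa [extChartAt_source] at hys
  have hy' : y ∈ (trivializationAt E (TangentSpace I) x₀).baseSet := by
    rwa [TangentBundle.trivializationAt_baseSet]
  have hzy : z = extChartAt I x₀ y := ((extChartAt I x₀).right_inv hz).symm
  rw [hzy, vectorInChart_extChartAt hy, extend_eq_symmL hy,
    Trivialization.continuousLinearMapAt_symmL _ hy']

/-- Mathlib's pullback of `Y` by the inverse extended chart (the expression through which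
`mlieBracket` is defined) is `Ŷ` on the chart target. [folklore] -/
theorem mpullbackWithin_extChartAt_symm_eq_vectorInChart {z : E}
    (hz : z ∈ (extChartAt I x₀).target) (Y : Π x : M, TangentSpace I x) :
    mpullbackWithin 𝓘(ℝ, E) I (extChartAt I x₀).symm Y (range I) z = vectorInChart x₀ Y z := by
  set y := (extChartAt I x₀).symm z with hy_def
  have hys : y ∈ (extChartAt I x₀).source := (extChartAt I x₀).map_target hz
  have hy : y ∈ (chartAt H x₀).source := by rwa [extChartAt_source] at hys
  have hzy : z = extChartAt I x₀ y := ((extChartAt I x₀).right_inv hz).symm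
  rw [mpullbackWithin_apply]
  change (mfderivWithin 𝓘(ℝ, E) I (extChartAt I x₀).symm (range I) z).inverse (Y y) =
    vectorInChart x₀ Y z
  rw [hzy, inverse_mfderivWithin_extChartAt_symm hys, vectorInChart_extChartAt hy,
    TangentBundle.continuousLinearMapAt_trivializationAt hy]
  rfl

/-- The same, for the pullback within `univ` (boundaryless model). [folklore] -/
theorem mpullbackWithin_univ_extChartAt_symm_eq_vectorInChart [I.Boundaryless] {z : E}
    (hz : z ∈ (extChartAt I x₀).target) (Y : Π x : M, TangentSpace I x) :
    mpullbackWithin 𝓘(ℝ, E) I (extChartAt I x₀).symm Y univ z = vectorInChart x₀ Y z := by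
  rw [← ModelWithCorners.Boundaryless.range_eq_univ (I := I)]
  exact mpullbackWithin_extChartAt_symm_eq_vectorInChart x₀ hz Y

end Chart

/-! ### Calculus at the centre of the chart -/

section Centre

/-- At the centre, the (junk-valued) inverse of `dφ_{x₀} = id` acts as the identity.
[folklore] -/
theorem inverse_mfderiv_extChartAt_self_apply (x₀ : M) (w : TangentSpace I x₀) :
    (mfderiv I 𝓘(ℝ, E) (extChartAt I x₀) x₀).inverse w = w := by
  have hid : mfderiv I 𝓘(ℝ, E) (extChartAt I x₀) x₀ w = w := by
    rw [mfderiv_extChartAt_self]; rfl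
  have h := (isInvertible_mfderiv_extChartAt (I := I) (mem_extChartAt_source x₀)).inverse_apply_self w
  rwa [hid] at h

variable [I.Boundaryless]

omit [IsManifold I ∞ M] in
/-- **`mvfderiv` at the centre of the chart is the Fréchet derivative of the chart expression**:
`df_{x₀}(v) = D(f ∘ φ⁻¹)(φ x₀) v` for `f` differentiable at `x₀` (boundaryless model, so that the
derivative within `range I` is a plain derivative, and `dφ_{x₀} = id`). [folklore] -/
theorem mvfderiv_eq_fderiv_extChartAt {F : Type*} [NormedAddCommGroup F] [NormedSpace ℝ F]
    {f : M → F} {x₀ : M} (hf : MDifferentiableAt I 𝓘(ℝ, F) f x₀) (v : TangentSpace I x₀) :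
    mvfderiv I f x₀ v = fderiv ℝ (f ∘ (extChartAt I x₀).symm) (extChartAt I x₀ x₀) v := by
  have hw : writtenInExtChartAt I 𝓘(ℝ, F) x₀ f = f ∘ (extChartAt I x₀).symm := by
    ext z
    simp [writtenInExtChartAt]
  simp only [mvfderiv, ContinuousLinearMap.coe_comp, comp_apply]
  rw [hf.mfderiv, hw, ModelWithCorners.Boundaryless.range_eq_univ, fderivWithin_univ]
  rfl

/-- **The bracket with an extended vector, in the chart**: `[Ã, Y](x₀) = DŶ(φ x₀) A` for the
canonical extension `Ã` of `A ∈ T_{x₀} M` and `Y` differentiable at `x₀` (Mathlib defines the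
bracket through the chart at `x₀`, `mlieBracketWithin_apply`; there `Ã` has constant components
and `dφ_{x₀} = id`). O'Neill 1983, Ch. 1, Lemma 1.18 ff. (`[V, W] = ∑ (V Wʲ - W Vʲ) ∂ⱼ`).
[cite: ONeill1983, Ch. 1, Lemma 1.18] -/
theorem mlieBracket_extend_left_eq_fderiv_vectorInChart (Y : Π x : M, TangentSpace I x) (x₀ : M)
    (A : TangentSpace I x₀) :
    mlieBracket I (extend E A) Y x₀ = fderiv ℝ (vectorInChart x₀ Y) (extChartAt I x₀ x₀) A := by
  rw [← mlieBracketWithin_univ, mlieBracketWithin_apply, inverse_mfderiv_extChartAt_self_apply,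
    preimage_univ, univ_inter, ModelWithCorners.Boundaryless.range_eq_univ, lieBracketWithin_univ]
  -- the chart expressions of `Ã` (constant) and of `Y`
  have hA : mpullbackWithin 𝓘(ℝ, E) I (extChartAt I x₀).symm (extend E A) univ =ᶠ[𝓝 (extChartAt I x₀ x₀)]
      fun _ ↦ (A : E) := by
    filter_upwards [extChartAt_target_mem_nhds (I := I) x₀] with z hz
    rw [mpullbackWithin_univ_extChartAt_symm_eq_vectorInChart x₀ hz, vectorInChart_extend x₀ hz]
  have hYc : mpullbackWithin 𝓘(ℝ, E) I (extChartAt I x₀).symm Y univ =ᶠ[𝓝 (extChartAt I x₀ x₀)]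
      vectorInChart x₀ Y := by
    filter_upwards [extChartAt_target_mem_nhds (I := I) x₀] with z hz
    rw [mpullbackWithin_univ_extChartAt_symm_eq_vectorInChart x₀ hz]
  rw [lieBracket_eq]
  dsimp only
  rw [hA.fderiv_eq, hYc.fderiv_eq, hA.eq_of_nhds, hYc.eq_of_nhds, vectorInChart_self]
  simp

variable [CompleteSpace E]

/-- A vector field differentiable at `x₀` has a differentiable chart expression at `φ x₀`
(Mathlib's `differentiableWithinAt_mpullbackWithin_vectorField`). [folklore] -/
theorem differentiableAt_vectorInChart {Y : Π x : M, TangentSpace I x} {x₀ : M}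
    (hY : MDiffAt (T% Y) x₀) :
    DifferentiableAt ℝ (vectorInChart x₀ Y) (extChartAt I x₀ x₀) := by
  have h := (hY.mdifferentiableWithinAt (s := univ)).differentiableWithinAt_mpullbackWithin_vectorField
  rw [preimage_univ, univ_inter] at h
  have h' : DifferentiableAt ℝ
      (mpullbackWithin 𝓘(ℝ, E) I (extChartAt I x₀).symm Y (range I)) (extChartAt I x₀ x₀) :=
    h.differentiableAt (by
      rw [ModelWithCorners.Boundaryless.range_eq_univ]
      exact univ_mem)
  refine h'.congr_of_eventuallyEq ?_
  filter_upwards [extChartAt_target_mem_nhds (I := I) x₀] with z hz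
  exact (mpullbackWithin_extChartAt_symm_eq_vectorInChart x₀ hz Y).symm

end Centre

/-! ### Smoothness of the chart expression of the metric -/

section Smooth

variable (g : PseudoRiemannianMetric I ∞ E (TangentSpace I : M → Type _)) (x₀ : M)

set_option maxSynthPendingDepth 2 in
-- nested operator spaces `E →L E →L ℝ` over the tangent fibres (compare Mathlib's
-- `Analysis/Normed/Operator/Bilinear.lean`)
/-- **The components of a `C^∞` metric in the coordinate frame of the chart at `x₀` are `C^∞`
on the chart domain** (the fibre coordinate of the smooth section `g` in the trivialization of
the bundle of bilinear forms at `x₀`, `Trivialization.contMDiffOn_iff`). [folklore] -/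
theorem contMDiffOn_bilinInChart :
    ContMDiffOn I 𝓘(ℝ, E →L[ℝ] E →L[ℝ] ℝ) ∞ (bilinInChart g x₀) (chartAt H x₀).source := by
  set e := trivializationAt (E →L[ℝ] E →L[ℝ] ℝ)
    (fun b : M ↦ TangentSpace I b →L[ℝ] TangentSpace I b →L[ℝ] ℝ) x₀ with he
  have hmem : ∀ y ∈ (chartAt H x₀).source, y ∈ e.baseSet := by
    intro y hy
    rw [he, hom_trivializationAt_baseSet, hom_trivializationAt_baseSet,
      TangentBundle.trivializationAt_baseSet]
    exact ⟨hy, hy, mem_univ _⟩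
  have hmaps : MapsTo (fun y : M ↦ TotalSpace.mk' (E →L[ℝ] E →L[ℝ] ℝ)
      (E := fun b : M ↦ TangentSpace I b →L[ℝ] TangentSpace I b →L[ℝ] ℝ) y (g.val y))
      (chartAt H x₀).source e.source := by
    intro y hy
    rw [e.mem_source]
    exact hmem y hy
  have h := (e.contMDiffOn_iff hmaps).1 g.contMDiff.contMDiffOn
  refine h.2.congr fun y hy ↦ ?_
  have hy' : y ∈ (trivializationAt E (TangentSpace I) x₀).baseSet := by
    rwa [TangentBundle.trivializationAt_baseSet]
  exact (trivializationAt_bilin_snd x₀ hy' (g.val y)).symm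

/-- **The chart expression `Ĝ` of a `C^∞` metric is `C^∞` on the chart target** (as a map
between normed spaces). [folklore] -/
theorem contDiffOn_metricInChart :
    ContDiffOn ℝ ∞ (metricInChart g x₀) ((extChartAt I x₀).target) := by
  have hsymm : ContMDiffOn 𝓘(ℝ, E) I ∞ (extChartAt I x₀).symm (extChartAt I x₀).target :=
    contMDiffOn_extChartAt_symm x₀
  have hmaps : MapsTo (extChartAt I x₀).symm (extChartAt I x₀).target (chartAt H x₀).source := by
    intro z hz
    rw [← extChartAt_source (I := I)]
    exact (extChartAt I x₀).map_target hz
  have h := (contMDiffOn_bilinInChart g x₀).comp hsymm hmaps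
  rw [contMDiffOn_iff_contDiffOn] at h
  exact h

variable [I.Boundaryless]

/-- `Ĝ` is `C^∞` at every point of the chart target (which is open for a boundaryless model).
[folklore] -/
theorem contDiffAt_metricInChart {z : E} (hz : z ∈ (extChartAt I x₀).target) :
    ContDiffAt ℝ ∞ (metricInChart g x₀) z :=
  (contDiffOn_metricInChart g x₀).contDiffAt ((isOpen_extChartAt_target x₀).mem_nhds hz)

/-- The derivative of `z ↦ Ĝ(z)(a, b)` is the derivative of `Ĝ` evaluated at `(a, b)`.
[folklore] -/
theorem fderiv_metricInChart_apply_apply {z : E}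
    (hz : z ∈ (extChartAt I x₀).target) (a b w : E) :
    fderiv ℝ (fun z ↦ metricInChart g x₀ z a b) z w = fderiv ℝ (metricInChart g x₀) z w a b := by
  have hd : DifferentiableAt ℝ (metricInChart g x₀) z :=
    (contDiffAt_metricInChart g x₀ hz).differentiableAt (by simp)
  rw [fderiv_clm_apply (hd.clm_apply (differentiableAt_const a)) (differentiableAt_const b),
    fderiv_clm_apply hd (differentiableAt_const a)]
  simp

end Smooth

/-! ### The Lie derivative of the metric in the chart at `x₀` -/

section LieDeriv

variable [I.Boundaryless] [FiniteDimensional ℝ E] [CompleteSpace E]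
  (g : PseudoRiemannianMetric I ∞ E (TangentSpace I : M → Type _))
  {cov : CovariantDerivative I E (TangentSpace I : M → Type _)}

omit [FiniteDimensional ℝ E] [CompleteSpace E] in
/-- **The derivative of a metric coefficient along `Y`, in the chart**: for the canonical
extensions `Ã, B̃` of `A, B ∈ T_{x₀} M` (constant components in the chart at `x₀`),
`Y₀ g(Ã, B̃) = DĜ(φ x₀)[Y₀](A, B)` (chain rule; `metricInChart_extChartAt_apply`). [folklore] -/
theorem mvfderiv_val_extend_extend (x₀ : M) (A B Y₀ : TangentSpace I x₀) :
    mvfderiv I (fun y ↦ g.val y (extend E A y) (extend E B y)) x₀ Y₀ =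
      fderiv ℝ (fun z ↦ metricInChart g x₀ z A B) (extChartAt I x₀ x₀) Y₀ := by
  have hf : MDifferentiableAt I 𝓘(ℝ, ℝ) (fun y ↦ g.val y (extend E A y) (extend E B y)) x₀ :=
    g.mdifferentiableAt_val_apply (mdifferentiableAt_extend ..) (mdifferentiableAt_extend ..)
  rw [mvfderiv_eq_fderiv_extChartAt hf]
  congr 1
  refine Filter.EventuallyEq.fderiv_eq ?_
  filter_upwards [extChartAt_target_mem_nhds (I := I) x₀] with z hz
  set y := (extChartAt I x₀).symm z with hy_def
  have hys : y ∈ (extChartAt I x₀).source := (extChartAt I x₀).map_target hz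
  have hy : y ∈ (chartAt H x₀).source := by rwa [extChartAt_source] at hys
  have hzy : z = extChartAt I x₀ y := ((extChartAt I x₀).right_inv hz).symm
  rw [comp_apply, ← hy_def, hzy, metricInChart_extChartAt_apply g hy]

/-- **The Lie derivative of the metric in a chart**: `(ℒ_Y g)_{ab} = Yᶜ ∂_c g_{ab} +
g_{cb} ∂_a Yᶜ + g_{ac} ∂_b Yᶜ`, the coordinate reading of O'Neill 1983, Ch. 9, proof of
Prop. 9.25, `(L_X g)(V, W) = X⟨V, W⟩ - ⟨[X, V], W⟩ - ⟨V, [X, W]⟩ = ⟨D_V X, W⟩ + ⟨V, D_W X⟩`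
(and Topping 2006, (2.3.8), `ℒ_{ω♯} g(X, W) = ∇ω(X, W) + ∇ω(W, X)`). For a `C^∞` metric `g` on a
manifold with boundaryless finite-dimensional complete model, a Levi-Civita connection
`∇ = cov` of `g`, a vector field `Y` differentiable at `x₀` and `A, B ∈ T_{x₀} M`, with
`Ĝ = metricInChart g x₀`, `Ŷ = vectorInChart x₀ Y`, `z₀ = φ x₀`:
`ℒ_Y g (A, B) := g(∇_A Y, B) + g(A, ∇_B Y) = DĜ(z₀)[Y₀](A, B) + g(DŶ(z₀) A, B) + g(A, DŶ(z₀) B)`.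
Proof: torsion-freeness on `(Ã, Y)`, `(B̃, Y)` (Mathlib's `torsion_eq_zero_iff`), compatibility
on `(Y; Ã, B̃)` — this is O'Neill's chain of identities — then `mvfderiv_val_extend_extend` and
`mlieBracket_extend_left_eq_fderiv_vectorInChart`. [cite: ONeill1983, Ch. 9, Prop. 9.25 (proof)]
[cite: Topping2006, §2.3, (2.3.8)] -/
theorem lieDerivMetric_eq_chart (hLC : g.IsLeviCivita cov) {Y : Π x : M, TangentSpace I x}
    {x₀ : M} (hY : MDiffAt (T% Y) x₀) (A B : TangentSpace I x₀) :
    lieDerivMetric g cov Y x₀ A B =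
      fderiv ℝ (fun z ↦ metricInChart g x₀ z A B) (extChartAt I x₀ x₀) (Y x₀)
        + g.val x₀ (fderiv ℝ (vectorInChart x₀ Y) (extChartAt I x₀ x₀) A) B
        + g.val x₀ A (fderiv ℝ (vectorInChart x₀ Y) (extChartAt I x₀ x₀) B) := by
  have hT : ∀ {X Y : Π x : M, TangentSpace I x} {x : M}, MDiffAt (T% X) x → MDiffAt (T% Y) x →
      cov Y x (X x) - cov X x (Y x) = mlieBracket I X Y x :=
    (CovariantDerivative.torsion_eq_zero_iff cov).1 hLC.1
  have hA : MDiffAt (T% (extend E A)) x₀ := mdifferentiableAt_extend ..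
  have hB : MDiffAt (T% (extend E B)) x₀ := mdifferentiableAt_extend ..
  -- torsion-freeness: `∇_A Y = ∇_{Y₀} Ã + [Ã, Y]`
  have tA := hT hA hY
  have tB := hT hB hY
  rw [extend_apply_self] at tA tB
  have eA : cov Y x₀ A = cov (extend E A) x₀ (Y x₀) + mlieBracket I (extend E A) Y x₀ := by
    rw [← tA]; abel
  have eB : cov Y x₀ B = cov (extend E B) x₀ (Y x₀) + mlieBracket I (extend E B) Y x₀ := by
    rw [← tB]; abel
  -- compatibility: `Y₀ g(Ã, B̃) = g(∇_{Y₀} Ã, B) + g(A, ∇_{Y₀} B̃)`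
  have c := hLC.2 hY hA hB
  rw [extend_apply_self, extend_apply_self, mvfderiv_val_extend_extend] at c
  -- assemble
  unfold lieDerivMetric
  rw [eA, eB, map_add, _root_.add_apply, map_add, c,
    mlieBracket_extend_left_eq_fderiv_vectorInChart Y x₀ A,
    mlieBracket_extend_left_eq_fderiv_vectorInChart Y x₀ B]
  ring

end LieDeriv

end Literature.Geometry.Riemannian
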